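import Literature.Computability.Cryptography.Harvey2021Search
import Literature.Computability.Cryptography.Harvey2021Reductions
import HarnessLib

/-!
# Harvey 2021: the algorithm's lemmas in integer arithmetic

Continuing `Harvey2021.lean` (Lemmas 3.1, 3.3), `Harvey2021Search.lean` (`prop42_witness`, the
correctness certificate of the main search) and `Harvey2021Reductions.lean` (reduction to
semiprimes).  A verified MACHINE for Theorem 1.1 computes with natural numbers only — integer
square roots, residues `a^i mod N`, gcds — so every step of the printed correctness proofs is
needed in an integer form, which this file supplies once (for both machine lines of the
programme, `Complexity/NumPrograms*.lean` and `Complexity/StackHarvey*.lean`):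

* **the main search** (Alg. 2 / Prop. 4.2): `ceil_sqrt_eq` (`⌈√x⌉ = ⌊√(x−1)⌋ + 1`), the
  integer ceiling `cab N a b = ⌈(4abN)^{1/2}⌉` (`cab_eq`), the integer giant-step count
  `Jab N r m a b = ⌊(⌊√N⌋+1)/(4rm⌊√(ab)⌋)⌋ + 1` (`lt_Jab`: it covers the real range of `j`), and
  **`bsgs_witness`** — `prop42_witness` restated with `cab`, `Jab` and the inverse-free
  baby-step/giant-step relation `α^{(J−1)m+i} = α^{(J−1−j)m} · α^{aN+b−c_{ab}}` (so the machine
  never inverts modulo `N`); **`lemma31_integer`** — Lemma 3.1 with `⌊√·⌋`: from `u = aq + bp`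
  one gcd of `(u + ⌊√(u²−4abN)⌋)/2` with `N` is a proper factor;
* **the supply of an element of large order** (replacing Prop. 2.7 = Hittmeir 2018, Thm. 6.2,
  by the part of Hittmeir's Algorithm 6.1 that the `N^{1/5+o(1)}` bound actually needs):
  `run_pow_eq_one_absurd` (at most `M` consecutive bases below the least prime factor have
  `a^M = 1`: `X^M − 1` has `≤ M` roots in `ℤ/p`), `dvd_pred_of_order_checks` (if `a^k ≡ 1` and
  all `gcd(N, a^j mod N − 1) = 1`, `j < k`, then `k ∣ p − 1` for every prime `p ∣ N`),
  `two_mul_le_lcm_of_pow` (the modulus of the congruence `p ≡ 1` at least doubles per round),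
  `exists_ap_minFac`, `ap_hit_proper` (the class `1 (mod M)` then contains `minFac N ≤ √N`, and
  the first hit of a scan of it is a proper factor), `pow_injOn_of_checks` (no `a^i ≡ 1`,
  `i ≤ D` ⇒ the powers `a^i`, `i ≤ D`, are distinct);
* **the driver** (proof of Thm. 1.1): `primeFactorsList_eq_cons`, the strip loop `strip` and
  **`strip_spec`** (recording least prime factors `≤ T` and dividing them out lists a prefix of
  `Nat.primeFactorsList`, in order), `strip_cofactor_length` (`≤ 2` prime factors remain when
  `N ≤ T³`), `cofactor_cases` (prime / `p²` / `pq`), `sqrt_mul_self_cases` (the square test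
  tells them apart).

## References

* D. Harvey, *An exponent one-fifth algorithm for deterministic integer factorisation*,
  Math. Comp. 90 (2021) 2937–2950: Lem. 3.1, Prop. 4.2 and its proof, proof of Thm 1.1
  (arXiv:2010.05450: Lem. 10, Prop. 15, Thm. 1). [Harvey2021]
* M. Hittmeir, *A babystep-giantstep method for faster deterministic integer factorization*,
  Math. Comp. 87 (2018) 2915–2935, §6, Algorithm 6.1 and the theorem following it (arXiv
  1608.08766): the order-finding loop and its termination argument. [Hittmeir2018]
-/

namespace Literature.Computability.Cryptography.Harvey2021

open Real Polynomial

/-! ### The main search in integer arithmetic -/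

/-- `⌈√x⌉ = ⌊√(x−1)⌋ + 1` for `x ≥ 1` (integer square roots only). [folklore] -/
theorem ceil_sqrt_eq {x : ℕ} (hx : 1 ≤ x) : ⌈Real.sqrt x⌉₊ = Nat.sqrt (x - 1) + 1 := by
  set s := Nat.sqrt (x - 1) with hs
  have h1 : s * s ≤ x - 1 := Nat.sqrt_le (x - 1)
  have h2 : x - 1 < (s + 1) * (s + 1) := Nat.lt_succ_sqrt (x - 1)
  have hlo : (s : ℝ) < Real.sqrt x := by
    rw [Real.lt_sqrt (by positivity), sq]
    have : s * s < x := by omega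
    exact_mod_cast this
  have hhi : Real.sqrt x ≤ (s : ℝ) + 1 := by
    rw [Real.sqrt_le_left (by positivity), sq]
    have : x ≤ (s + 1) * (s + 1) := by omega
    exact_mod_cast this
  refine le_antisymm ?_ ?_
  · exact Nat.ceil_le.2 (by exact_mod_cast hhi)
  · exact Nat.lt_ceil.2 (by exact_mod_cast hlo)

/-- The ceiling `c_{ab} = ⌈(4abN)^{1/2}⌉` in integer arithmetic. [folklore] -/
def cab (N a b : ℕ) : ℕ := Nat.sqrt (4 * a * b * N - 1) + 1

/-- The number of giant steps `J_{ab}` examined for the pair `(a, b)` in integer arithmetic: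
`⌊(⌊√N⌋ + 1) / (4 r m ⌊√(ab)⌋)⌋ + 1 > N^{1/2} / (4 r m (ab)^{1/2})`. [folklore] -/
def Jab (N r m a b : ℕ) : ℕ := (Nat.sqrt N + 1) / (4 * r * m * Nat.sqrt (a * b)) + 1

/-- `cab` is the printed ceiling `⌈(4abN)^{1/2}⌉` (`a, b, N ≥ 1`). [folklore] -/
theorem cab_eq {N a b : ℕ} (hN : 1 ≤ N) (ha : 0 < a) (hb : 0 < b) :
    cab N a b = ⌈Real.sqrt (4 * (a * b) * N)⌉₊ := by
  have h1 : 1 ≤ 4 * a * b * N := by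
    have := Nat.mul_le_mul (Nat.mul_le_mul (Nat.mul_le_mul (le_refl 4) ha) hb) hN; omega
  have : ((4 * a * b * N : ℕ) : ℝ) = 4 * ((a : ℝ) * b) * N := by push_cast; ring
  rw [cab, ← ceil_sqrt_eq h1, this]

/-- The real bound on `j` implies `j < J_{ab}`. [folklore] -/
theorem lt_Jab {N r m a b j : ℕ} (hr : 0 < r) (hm : 0 < m) (ha : 0 < a) (hb : 0 < b)
    (hj : (j : ℝ) < Real.sqrt N / (4 * r * m * Real.sqrt (a * b))) : j < Jab N r m a b := by
  unfold Jab
  set D := 4 * r * m * Nat.sqrt (a * b) with hD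
  have hab : 1 ≤ Nat.sqrt (a * b) := Nat.le_sqrt.2 (by nlinarith)
  have hD0 : 0 < D := by rw [hD]; positivity
  -- `√N < ⌊√N⌋ + 1` and `⌊√(ab)⌋ ≤ √(ab)`
  have hsN : Real.sqrt N < (Nat.sqrt N : ℝ) + 1 := by
    have := Nat.lt_succ_sqrt' N
    rw [Real.sqrt_lt' (by positivity)]
    exact_mod_cast this
  have hsab : (Nat.sqrt (a * b) : ℝ) ≤ Real.sqrt ((a : ℝ) * b) := by
    rw [Real.le_sqrt (by positivity) (by positivity)]
    have := Nat.sqrt_le' (a * b)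
    exact_mod_cast this
  have hY : Real.sqrt N / (4 * r * m * Real.sqrt (a * b)) < ((Nat.sqrt N + 1 : ℕ) : ℝ) / (D : ℝ) := by
    rw [hD]; push_cast
    have h4 : (0 : ℝ) < 4 * r * m * (Nat.sqrt (a * b) : ℝ) := by positivity
    have h5 : (0 : ℝ) < 4 * r * m * Real.sqrt ((a : ℝ) * b) := by positivity
    calc Real.sqrt N / (4 * r * m * Real.sqrt (a * b))
        < ((Nat.sqrt N : ℝ) + 1) / (4 * r * m * Real.sqrt (a * b)) := div_lt_div_of_pos_right hsN h5
      _ ≤ ((Nat.sqrt N : ℝ) + 1) / (4 * r * m * (Nat.sqrt (a * b) : ℝ)) := by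
          apply div_le_div_of_nonneg_left (by positivity) h4
          exact mul_le_mul_of_nonneg_left hsab (by positivity)
  have hfl : ((Nat.sqrt N + 1 : ℕ) : ℝ) / (D : ℝ) < ((Nat.sqrt N + 1) / D : ℕ) + 1 := by
    have h' : Nat.sqrt N + 1 < ((Nat.sqrt N + 1) / D + 1) * D := by
      rw [Nat.add_mul, one_mul]; exact Nat.lt_div_mul_add hD0
    rw [div_lt_iff₀ (by exact_mod_cast hD0)]
    exact_mod_cast h'
  have : (j : ℝ) < (((Nat.sqrt N + 1) / D + 1 : ℕ) : ℝ) := by push_cast; linarith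
  exact_mod_cast this

/-- **The witness of the main search in integer arithmetic** (proof of Prop. 4.2): for
`N = pq` with `(N/r)^{1/2} ≤ p < N^{1/2}`, `m ≥ 1`, `α ≠ 0` in `ℤ/p`, and any `Jmax` with
`J_{ab} ≤ Jmax` for all pairs, there are `a, b ≥ 1`, `ab ≤ r`, `i < m`, `j < J_{ab}` with
`i + jm + c_{ab} = aq + bp` and the inverse-free baby-step/giant-step relation
`α^{(Jmax−1)m + i} = α^{(Jmax−1−j)m} · α^{aN + b − c_{ab}}` in `ℤ/p`. [cite: Harvey2021, proof of Prop. 4.2] -/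
theorem bsgs_witness {p : ℕ} [hp : Fact p.Prime] {N q r m Jmax : ℕ} (hq : 0 < q) (hr : 0 < r) (hm : 0 < m)
    (hN : N = p * q) (hlow : Real.sqrt (N / r) ≤ p) (hup : (p : ℝ) < Real.sqrt N)
    (hJ : ∀ a b, 0 < a → 0 < b → a * b ≤ r → Jab N r m a b ≤ Jmax) {α : ZMod p} (hα : α ≠ 0) :
    ∃ a b i j : ℕ, 0 < a ∧ 0 < b ∧ a * b ≤ r ∧ i < m ∧ j < Jab N r m a b ∧
      cab N a b ≤ a * q + b * p ∧ cab N a b ≤ a * N + b ∧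
      i + j * m + cab N a b = a * q + b * p ∧
      α ^ ((Jmax - 1) * m + i) = α ^ ((Jmax - 1 - j) * m) * α ^ (a * N + b - cab N a b) := by
  have hN1 : 1 ≤ N := by rw [hN]; exact Nat.mul_pos hp.out.pos hq
  obtain ⟨a, b, i, j, ha, hb, hab, hi, hj, hc1, hc2, hu, hrel⟩ := prop42_witness hq hr hm hN hlow hup hα
  rw [← cab_eq hN1 ha hb] at hc1 hc2 hu hrel
  have hjJ : j < Jab N r m a b := lt_Jab hr hm ha hb hj
  refine ⟨a, b, i, j, ha, hb, hab, hi, hjJ, hc1, hc2, hu, ?_⟩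
  have hjm : j ≤ Jmax - 1 := by have := hJ a b ha hb hab; omega
  -- multiply `α^i = (α^{jm})⁻¹ t` by `α^{(Jmax-1) m}`
  have e1 : (Jmax - 1) * m = (Jmax - 1 - j) * m + j * m := by
    rw [← Nat.add_mul]; congr 1; omega
  rw [Nat.add_comm ((Jmax - 1) * m) i, pow_add, hrel, e1, pow_add]
  have hz : α ^ (j * m) ≠ 0 := pow_ne_zero _ hα
  calc (α ^ (j * m))⁻¹ * α ^ (a * N + b - cab N a b) * (α ^ ((Jmax - 1 - j) * m) * α ^ (j * m))
      = α ^ ((Jmax - 1 - j) * m) * α ^ (a * N + b - cab N a b) * ((α ^ (j * m))⁻¹ * α ^ (j * m)) := by ring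
    _ = α ^ ((Jmax - 1 - j) * m) * α ^ (a * N + b - cab N a b) := by rw [inv_mul_cancel₀ hz, mul_one]

/-- **Lemma 3.1 in integer arithmetic** (recovery of `p`, `q` from `u = aq + bp`): with
`D = u² − 4abN = (aq − bp)²`, `y = (u + √D)/2 = max (aq, bp)`, one gcd with `N` gives a prime
factor, provided `a < p` and `b < q` (in Algorithm 2: `a, b ≤ r < p < q`). [cite: Harvey2021, Lem. 3.1] -/
theorem lemma31_integer {N p q a b u : ℕ} (hp : p.Prime) (hq : q.Prime) (hN : N = p * q) (ha : 0 < a) (hb : 0 < b)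
    (hap : a < p) (hbq : b < q) (hu : u = a * q + b * p) :
    4 * a * b * N ≤ u * u ∧
    Nat.sqrt (u * u - 4 * a * b * N) * Nat.sqrt (u * u - 4 * a * b * N) = u * u - 4 * a * b * N ∧
    (1 < Nat.gcd ((u + Nat.sqrt (u * u - 4 * a * b * N)) / 2) N ∧ Nat.gcd ((u + Nat.sqrt (u * u - 4 * a * b * N)) / 2) N < N) := by
  subst hu; subst hN
  -- the discriminant is `(aq - bp)²` (as naturals, via `max - min`)
  set x := a * q with hx
  set y := b * p with hy
  have hsq : (x + y) * (x + y) - 4 * a * b * (p * q) = (max x y - min x y) * (max x y - min x y) := by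
    rcases le_total x y with h | h
    · rw [max_eq_right h, min_eq_left h]
      have : 4 * a * b * (p * q) = 4 * x * y := by rw [hx, hy]; ring
      rw [this]
      have e : (x + y) * (x + y) = 4 * x * y + (y - x) * (y - x) := by
        zify [h]; ring
      omega
    · rw [max_eq_left h, min_eq_right h]
      have : 4 * a * b * (p * q) = 4 * x * y := by rw [hx, hy]; ring
      rw [this]
      have e : (x + y) * (x + y) = 4 * x * y + (x - y) * (x - y) := by
        zify [h]; ring
      omega
  have h4 : 4 * a * b * (p * q) ≤ (x + y) * (x + y) := by
    have : 4 * a * b * (p * q) = 4 * x * y := by rw [hx, hy]; ring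
    rw [this]; zify; nlinarith [sq_nonneg ((x : ℤ) - (y : ℤ))]
  refine ⟨h4, ?_, ?_⟩
  · rw [hsq, Nat.sqrt_eq]
  · rw [hsq, Nat.sqrt_eq]
    have hmax : (x + y + (max x y - min x y)) / 2 = max x y := by
      rcases le_total x y with h | h
      · rw [max_eq_right h, min_eq_left h]; omega
      · rw [max_eq_left h, min_eq_right h]; omega
    rw [hmax]
    have hp1 := hp.one_lt; have hq1 := hq.one_lt
    rcases le_total x y with h | h
    · rw [max_eq_right h, hy]
      -- gcd (b p, p q) = p
      have : Nat.gcd (b * p) (p * q) = p := by rw [Nat.gcd_comm]; exact lemma31_recover hq hb hbq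
      rw [this]
      exact ⟨hp1, lt_mul_of_one_lt_right hp.pos hq1⟩
    · rw [max_eq_left h, hx]
      have : Nat.gcd (a * q) (p * q) = q := by
        rw [Nat.gcd_comm, mul_comm p q]; exact lemma31_recover hp ha hap
      rw [this]
      exact ⟨hq1, lt_mul_of_one_lt_left hq.pos hp1⟩


/-! ### An element of large order (the part of Hittmeir's Algorithm 6.1 that is needed) -/

/-- **At most `M` consecutive bases can have `a^M = 1` below the least prime factor**: if
`p` is prime and the `M + 1` integers `a₀+1, …, a₀+M+1 < p` all satisfy `a^M = 1` in `ℤ/p`,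
contradiction (`X^M − 1` has at most `M` roots in the field `ℤ/p`).
[cite: Hittmeir2018, §6, proof of the theorem after Alg. 6.1 (termination)] -/
theorem run_pow_eq_one_absurd {p M a0 : ℕ} (hp : p.Prime) (hM : 1 ≤ M) (hlt : a0 + M + 1 < p)
    (h : ∀ i, i ≤ M → (((a0 + 1 + i : ℕ) : ZMod p)) ^ M = 1) : False := by
  haveI : Fact p.Prime := ⟨hp⟩
  let f : ℕ → ZMod p := fun i => ((a0 + 1 + i : ℕ) : ZMod p)
  have hinj : Set.InjOn f (Finset.range (M + 1) : Finset ℕ) := by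
    intro i hi i' hi' hii'
    simp only [Finset.coe_range, Set.mem_Iio] at hi hi'
    have := (ZMod.natCast_eq_natCast_iff' _ _ p).1 hii'
    rw [Nat.mod_eq_of_lt (by omega), Nat.mod_eq_of_lt (by omega)] at this
    omega
  have hcard : ((Finset.range (M + 1)).image f).card = M + 1 := by
    rw [Finset.card_image_of_injOn hinj, Finset.card_range]
  have hsub : (Finset.range (M + 1)).image f ⊆ (Polynomial.nthRoots M (1 : ZMod p)).toFinset := by
    intro x hx
    simp only [Finset.mem_image, Finset.mem_range] at hx
    obtain ⟨i, hi, rfl⟩ := hx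
    rw [Multiset.mem_toFinset, Polynomial.mem_nthRoots (by omega)]
    exact h i (by omega)
  have h1 := Finset.card_le_card hsub
  have h2 : (Polynomial.nthRoots M (1 : ZMod p)).toFinset.card ≤ M :=
    (Multiset.toFinset_card_le _).trans (Polynomial.card_nthRoots M 1)
  omega

/-- Residues modulo `N` seen modulo a prime factor `p`. [folklore] -/
theorem cast_pow_mod {N p a j : ℕ} (hpN : p ∣ N) : ((a ^ j % N : ℕ) : ZMod p) = (a : ZMod p) ^ j := by
  rw [← Nat.cast_pow, ZMod.natCast_eq_natCast_iff', Nat.mod_mod_of_dvd _ hpN]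

/-- **The gcd checks force the order**: if `a^k ≡ 1 (mod N)` (`k ≥ 1`) and
`gcd (N, (a^j mod N) − 1) = 1` for all `1 ≤ j < k`, then `a` has order exactly `k` modulo every
prime factor `p` of `N`, whence `k ∣ p − 1`. [cite: Hittmeir2018, §6, Alg. 6.1 Steps 13–16 and Lemma 2.2] -/
theorem dvd_pred_of_order_checks {N a k p : ℕ} (hk : 1 ≤ k) (hak : a ^ k % N = 1)
    (hj : ∀ j, 1 ≤ j → j < k → Nat.gcd N (a ^ j % N - 1) = 1) (hp : p.Prime) (hpN : p ∣ N) : k ∣ p - 1 := by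
  haveI : Fact p.Prime := ⟨hp⟩
  have h2 := hp.two_le
  set u : ZMod p := (a : ZMod p) with hu
  have huk : u ^ k = 1 := by
    rw [← cast_pow_mod hpN, hak, Nat.cast_one]
  have hu0 : u ≠ 0 := by
    intro h0; rw [h0, zero_pow (by omega)] at huk; exact zero_ne_one huk
  have hord : orderOf u ∣ k := orderOf_dvd_of_pow_eq_one huk
  have hpos : 0 < orderOf u := orderOf_pos_iff.2 (isOfFinOrder_iff_pow_eq_one.2 ⟨k, hk, huk⟩)
  have hle : orderOf u ≤ k := Nat.le_of_dvd hk hord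
  have heq : orderOf u = k := by
    by_contra hne
    have hlt : orderOf u < k := lt_of_le_of_ne hle hne
    have h1 : u ^ orderOf u = 1 := pow_orderOf_eq_one u
    rw [← cast_pow_mod hpN] at h1
    -- so `a^j mod N ≡ 1 (mod p)`: `p` divides `(a^j mod N) - 1`
    have hm : (a ^ orderOf u % N) % p = 1 := by
      have := (ZMod.natCast_eq_natCast_iff' _ 1 p).1 (by rw [h1, Nat.cast_one])
      rwa [Nat.mod_eq_of_lt (show 1 < p by omega)] at this
    have hge : 1 ≤ a ^ orderOf u % N := by
      by_contra h0; push Not at h0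
      rw [show a ^ orderOf u % N = 0 by omega, Nat.zero_mod] at hm; exact zero_ne_one hm
    have hdvd : p ∣ a ^ orderOf u % N - 1 :=
      (Nat.modEq_iff_dvd' hge).1 (by rw [Nat.ModEq, Nat.mod_eq_of_lt (show 1 < p by omega), hm])
    have hg := hj (orderOf u) hpos hlt
    have : p ∣ Nat.gcd N (a ^ orderOf u % N - 1) := Nat.dvd_gcd hpN hdvd
    rw [hg] at this
    exact hp.one_lt.ne' (Nat.dvd_one.1 this)
  rw [← heq]
  exact ZMod.orderOf_dvd_card_sub_one hu0

/-- **Each round at least doubles the modulus**: if `a^k ≡ 1` but `a^M ≢ 1 (mod N)` then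
`k ∤ M`, so `lcm (M, k) ≥ 2M`. [cite: Hittmeir2018, §6, proof of the theorem after Alg. 6.1] -/
theorem two_mul_le_lcm_of_pow {N a M k : ℕ} (hN : 1 < N) (hk : 1 ≤ k) (hk1 : a ^ k % N = 1)
    (hM1 : a ^ M % N ≠ 1) : 2 * M ≤ Nat.lcm M k := by
  have hndvd : ¬ k ∣ M := by
    rintro ⟨t, rfl⟩
    apply hM1
    rw [pow_mul, Nat.pow_mod, hk1, one_pow, Nat.one_mod_eq_one.2 hN.ne']
  obtain ⟨t, ht⟩ := Nat.dvd_lcm_left M k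
  have hl0 : Nat.lcm M k ≠ 0 := Nat.lcm_ne_zero (by rintro rfl; exact hndvd (dvd_zero _)) (by omega)
  have ht2 : 2 ≤ t := by
    rcases Nat.lt_or_ge t 2 with h | h
    · interval_cases t
      · rw [mul_zero] at ht; exact absurd ht hl0
      · rw [mul_one] at ht; exact absurd (ht ▸ Nat.dvd_lcm_right M k) hndvd
    · exact h
  calc 2 * M = M * 2 := Nat.mul_comm _ _
    _ ≤ M * t := Nat.mul_le_mul_left _ ht2
    _ = Nat.lcm M k := ht.symm

/-- **The residue class `1 (mod M)` contains the least prime factor**: for composite `N > 1`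
whose prime factors are all `≡ 1 (mod M)`, `minFac N = 1 + M k` with `k ≥ 1` and
`(1 + M k)² ≤ N`. [cite: Hittmeir2018, §6, Alg. 6.1 Step 18] -/
theorem exists_ap_minFac {N M : ℕ} (hN : 1 < N) (hnp : ¬ N.Prime) (hres : ∀ p, p.Prime → p ∣ N → M ∣ p - 1) :
    ∃ k, 1 ≤ k ∧ 1 + M * k = N.minFac ∧ (1 + M * k) * (1 + M * k) ≤ N ∧ 1 + M * k < N := by
  have hmf : N.minFac.Prime := Nat.minFac_prime hN.ne'
  obtain ⟨k, hk⟩ := hres _ hmf (Nat.minFac_dvd N)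
  have h2 := hmf.two_le
  have hsq := Nat.minFac_sq_le_self (by omega) hnp
  rw [sq] at hsq
  have hk1 : 1 ≤ k := by
    rcases k with _ | k
    · rw [mul_zero] at hk; omega
    · exact Nat.succ_pos _
  have heq : 1 + M * k = N.minFac := by omega
  refine ⟨k, hk1, heq, by rwa [heq], ?_⟩
  rw [heq]
  exact (Nat.not_prime_iff_minFac_lt (by omega)).1 hnp

/-- **A hit in the class is a proper factor**: with `p = minFac N = 1 + M k₀` as above, any
`k ≤ k₀` with `gcd (1 + M k, N) > 1` yields `1 < gcd < N`. [folklore] -/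
theorem ap_hit_proper {N M k k0 : ℕ} (hk : k ≤ k0) (hlt : 1 + M * k0 < N) (hg : 1 < Nat.gcd (1 + M * k) N) :
    1 < Nat.gcd (1 + M * k) N ∧ Nat.gcd (1 + M * k) N < N ∧ Nat.gcd (1 + M * k) N ∣ N := by
  refine ⟨hg, ?_, Nat.gcd_dvd_right _ _⟩
  have h1 : Nat.gcd (1 + M * k) N ≤ 1 + M * k := Nat.le_of_dvd (by omega) (Nat.gcd_dvd_left _ _)
  have h2 : 1 + M * k ≤ 1 + M * k0 := by have := Nat.mul_le_mul_left M hk; omega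
  omega

/-- **No power hits one, so the order is large**: if `a^i mod N ≠ 1` for `1 ≤ i ≤ D` then the
powers `a^i`, `i ≤ D`, are pairwise distinct modulo `N` provided `a` is a unit. [folklore] -/
theorem pow_injOn_of_checks {N a D : ℕ} (hN : 1 < N) (hcop : Nat.Coprime a N)
    (h : ∀ i, 1 ≤ i → i ≤ D → a ^ i % N ≠ 1) {i i' : ℕ} (hi : i ≤ D) (hi' : i' ≤ D)
    (he : a ^ i % N = a ^ i' % N) : i = i' := by
  wlog hle : i ≤ i' generalizing i i'
  · exact (this hi' hi he.symm (by omega)).symm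
  rcases Nat.eq_or_lt_of_le hle with rfl | hlt
  · rfl
  exfalso
  have hu : IsUnit (a : ZMod N) := (ZMod.isUnit_iff_coprime a N).2 hcop
  have he' : (a : ZMod N) ^ i = (a : ZMod N) ^ i' := by
    have := (ZMod.natCast_eq_natCast_iff' (a ^ i) (a ^ i') N).2 he
    push_cast at this; exact this
  have hd : (a : ZMod N) ^ (i' - i) = 1 := by
    have : (a : ZMod N) ^ i' = (a : ZMod N) ^ i * (a : ZMod N) ^ (i' - i) := by
      rw [← pow_add]; congr 1; omega
    rw [this] at he'
    exact ((hu.pow i).mul_right_inj).1 (by rw [mul_one]; exact he'.symm)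
  have h1 : a ^ (i' - i) % N = 1 := by
    have := (ZMod.natCast_eq_natCast_iff' (a ^ (i' - i)) 1 N).1 (by push_cast; rw [hd])
    rwa [Nat.mod_eq_of_lt hN] at this
  exact h (i' - i) (by omega) (by omega) h1


/-! ### The driver: stripping small prime factors, the cofactor -/

/-- `Nat.primeFactorsList` peels off the least prime factor. [folklore] -/
theorem primeFactorsList_eq_cons {N : ℕ} (hN : 2 ≤ N) :
    N.primeFactorsList = N.minFac :: (N / N.minFac).primeFactorsList := by
  obtain ⟨k, rfl⟩ : ∃ k, N = k + 2 := ⟨N - 2, by omega⟩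
  rw [Nat.primeFactorsList]

/-- The strip loop as a function: `fuel` rounds of "if `N ≥ 2` and its least prime factor is at
most `T`, record it and divide it out". [cite: Harvey2021, Thm 1.1 (arXiv Thm 1), proof] -/
def strip (T : ℕ) : ℕ → ℕ → List ℕ × ℕ
  | 0, N => ([], N)
  | f + 1, N => if 2 ≤ N ∧ N.minFac ≤ T then ((N.minFac :: (strip T f (N / N.minFac)).1), (strip T f (N / N.minFac)).2)
      else ([], N)

/-- **The strip loop is a prefix of the factorisation**: with enough fuel (`N < 2^fuel`), the
recorded primes followed by the factorisation of the cofactor are `Nat.primeFactorsList N`, the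
cofactor divides `N`, and it is `< 2` or has all its prime factors `> T`. [cite: Harvey2021, Thm 1.1 (arXiv Thm 1), proof] -/
theorem strip_spec (T : ℕ) : ∀ (fuel N : ℕ), N < 2 ^ fuel →
    N.primeFactorsList = (strip T fuel N).1 ++ (strip T fuel N).2.primeFactorsList ∧
      (strip T fuel N).2 ∣ N ∧ ((strip T fuel N).2 < 2 ∨ T < (strip T fuel N).2.minFac) ∧
      (∀ p ∈ (strip T fuel N).1, p ≤ T) ∧ (strip T fuel N).2 ≤ N
  | 0, N, h => by
    refine ⟨by simp [strip], by simp [strip], Or.inl (by simp only [strip]; omega), by simp [strip], by simp [strip]⟩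
  | f + 1, N, h => by
    by_cases hc : 2 ≤ N ∧ N.minFac ≤ T
    · have hmf : 2 ≤ N.minFac := (Nat.minFac_prime (by omega)).two_le
      have hdiv : N / N.minFac < 2 ^ f := by
        have h1 : N / N.minFac ≤ N / 2 := Nat.div_le_div_left hmf (by omega)
        have h2 : N / 2 < 2 ^ f := by rw [pow_succ] at h; omega
        omega
      obtain ⟨i1, i2, i3, i4, i5⟩ := strip_spec T f (N / N.minFac) hdiv
      simp only [strip, hc, and_self, if_true]
      refine ⟨?_, ?_, i3, ?_, ?_⟩
      · rw [primeFactorsList_eq_cons hc.1, i1]; rfl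
      · exact i2.trans (Nat.div_dvd_of_dvd (Nat.minFac_dvd N))
      · intro p hp
        rcases List.mem_cons.1 hp with rfl | hp
        · exact hc.2
        · exact i4 p hp
      · exact i5.trans (Nat.div_le_self _ _)
    · simp only [strip, hc, if_false]
      refine ⟨by simp, dvd_rfl, ?_, by simp, le_rfl⟩
      rcases Nat.lt_or_ge N 2 with h2 | h2
      · exact Or.inl h2
      · exact Or.inr (by push Not at hc; exact hc h2)

/-- **The cofactor has at most two prime factors** when `T³ ≥ N`. [cite: Harvey2021, Thm 1.1 (arXiv Thm 1), proof] -/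
theorem strip_cofactor_length {T fuel N : ℕ} (hfuel : N < 2 ^ fuel) (hT : N ≤ T ^ 3) (h2 : 2 ≤ (strip T fuel N).2) :
    (strip T fuel N).2.primeFactorsList.length ≤ 2 := by
  obtain ⟨-, -, i3, -, i5⟩ := strip_spec T fuel N hfuel
  have hbig : T < (strip T fuel N).2.minFac := i3.resolve_left (by omega)
  refine length_primeFactorsList_le_two (by omega) (i5.trans hT) fun p hp => ?_
  exact lt_of_lt_of_le hbig (Nat.minFac_le_of_dvd (Nat.prime_of_mem_primeFactorsList hp).two_le
    (Nat.dvd_of_mem_primeFactorsList hp))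

/-- **The three shapes of the cofactor**: an integer `N ≥ 2` with at most two prime factors is a
prime, the square of a prime, or a product of two distinct primes, and its factorisation reads
accordingly. [cite: Harvey2021, Thm 1.1 (arXiv Thm 1), proof] -/
theorem cofactor_cases {N : ℕ} (hN : 2 ≤ N) (hlen : N.primeFactorsList.length ≤ 2) :
    (N.Prime ∧ N.primeFactorsList = [N]) ∨
      (∃ p, p.Prime ∧ N = p * p ∧ N.primeFactorsList = [p, p]) ∨
      (∃ p q, p.Prime ∧ q.Prime ∧ p < q ∧ N = p * q ∧ N.primeFactorsList = [p, q]) := by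
  have hprod := Nat.prod_primeFactorsList (show N ≠ 0 by omega)
  have hsorted := Nat.primeFactorsList_sorted N
  have hprime : ∀ p ∈ N.primeFactorsList, p.Prime := fun p hp => Nat.prime_of_mem_primeFactorsList hp
  match hl : N.primeFactorsList, hlen with
  | [], _ => rw [hl] at hprod; simp at hprod; omega
  | [p], _ =>
    rw [hl] at hprod hprime
    simp only [List.prod_cons, List.prod_nil, mul_one] at hprod
    subst hprod
    exact Or.inl ⟨hprime _ (by simp), rfl⟩
  | [p, q], _ =>
    rw [hl] at hprod hprime hsorted
    simp only [List.prod_cons, List.prod_nil, mul_one] at hprod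
    have hp := hprime p (by simp); have hq := hprime q (by simp)
    have hpq : p ≤ q := (List.pairwise_cons.1 (List.sortedLE_iff_pairwise.1 hsorted)).1 q (by simp)
    rcases Nat.eq_or_lt_of_le hpq with rfl | hlt
    · exact Or.inr (Or.inl ⟨p, hp, hprod.symm, rfl⟩)
    · exact Or.inr (Or.inr ⟨p, q, hp, hq, hlt, hprod.symm, rfl⟩)
  | a :: b :: c :: l, h => simp at h

/-- **The square test**: `⌊√N⌋² = N` holds for the square of a prime and fails for a prime and
for a product of two distinct primes. [cite: Harvey2021, Thm 1.1 (arXiv Thm 1), proof] -/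
theorem sqrt_mul_self_cases {p q : ℕ} (hp : p.Prime) (hq : q.Prime) :
    Nat.sqrt (p * p) * Nat.sqrt (p * p) = p * p ∧ Nat.sqrt p * Nat.sqrt p ≠ p ∧
      (p < q → Nat.sqrt (p * q) * Nat.sqrt (p * q) ≠ p * q) := by
  refine ⟨by rw [Nat.sqrt_eq], fun h => ?_, fun hlt h => ?_⟩
  · -- a prime is not a square
    have h2 := hp.two_le
    rcases (Nat.dvd_prime hp).1 (show Nat.sqrt p ∣ p from ⟨Nat.sqrt p, h.symm⟩) with h1 | h1
    · rw [h1, mul_one] at h; omega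
    · rw [h1] at h; nlinarith
  · -- `pq` with `p < q` is not a square: `p ∣ s`, then `p ∣ q`
    have hps : p ∣ Nat.sqrt (p * q) := by
      have : p ∣ Nat.sqrt (p * q) * Nat.sqrt (p * q) := by rw [h]; exact dvd_mul_right p q
      exact ((Nat.Prime.dvd_mul hp).1 this).elim id id
    obtain ⟨t, ht⟩ := hps
    have h' : p * (p * (t * t)) = p * q := by rw [← h, ht]; ring
    have hpq : p ∣ q := ⟨t * t, (Nat.eq_of_mul_eq_mul_left hp.pos h').symm⟩
    rcases (Nat.dvd_prime hq).1 hpq with h1 | h1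
    · exact hp.one_lt.ne' h1
    · exact hlt.ne h1

end Literature.Computability.Cryptography.Harvey2021
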